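import Summits.Ventures.QEC.Census.CertCoverProducers
import Summits.Ventures.QEC.Census.BB.A1s_n168_k6_3dfa5349.CoreDefs
import HarnessLib

set_option Elab.async false
set_option maxRecDepth 200000

/-!
# `[[168,6,16]]` one-level cover certificate of `A1s_n168_k6_3dfa5349` — ASSEMBLY side: the 42 translation automorphisms are cover-compatible row-map automorphisms
(`permCompatOK` with `ePermqs[i]` downstairs; `rowMapOKL` for `H^X` and `H^Z`, type-12 lockstep form) and the collector `hauts : autsCompatOK cov hx hz perms ePermqs rowss rowss`
(`CertCoverProducers.autsCompatOK_of_forallL`). Theorems only; KERNEL. qec-search-1 g5 (pattern of search-9 g5 `AutsA/B`/`Auts` p537997/p538421/p538895, merged into one module).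
-/

namespace Summit.Ventures.QEC.Census.A1s_n168_k6_3dfa5349

open Matrix Summit.Ventures.QEC.Census Literature.InformationTheory.QuantumCodes

/-- Automorphism 0 (translation `(0, 0)`): cover-compatible with `ePermqs[0]`, row-map automorphism of `H^X` and `H^Z`. -/
theorem aut0_ok : A1s_n168_k6_3dfa5349.cov.permCompatOK perm0 (ePermqs.getD 0 []) = true ∧ rowMapOKL hx perm0 rows0 = true ∧ rowMapOKL hz perm0 rows0 = true := by
  refine ⟨?_, ?_, ?_⟩ <;> decide +kernel

/-- Automorphism 1 (translation `(0, 1)`): cover-compatible with `ePermqs[1]`, row-map automorphism of `H^X` and `H^Z`. -/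
theorem aut1_ok : A1s_n168_k6_3dfa5349.cov.permCompatOK perm1 (ePermqs.getD 1 []) = true ∧ rowMapOKL hx perm1 rows1 = true ∧ rowMapOKL hz perm1 rows1 = true := by
  refine ⟨?_, ?_, ?_⟩ <;> decide +kernel

/-- Automorphism 2 (translation `(0, 2)`): cover-compatible with `ePermqs[2]`, row-map automorphism of `H^X` and `H^Z`. -/
theorem aut2_ok : A1s_n168_k6_3dfa5349.cov.permCompatOK perm2 (ePermqs.getD 2 []) = true ∧ rowMapOKL hx perm2 rows2 = true ∧ rowMapOKL hz perm2 rows2 = true := by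
  refine ⟨?_, ?_, ?_⟩ <;> decide +kernel

/-- Automorphism 3 (translation `(0, 3)`): cover-compatible with `ePermqs[3]`, row-map automorphism of `H^X` and `H^Z`. -/
theorem aut3_ok : A1s_n168_k6_3dfa5349.cov.permCompatOK perm3 (ePermqs.getD 3 []) = true ∧ rowMapOKL hx perm3 rows3 = true ∧ rowMapOKL hz perm3 rows3 = true := by
  refine ⟨?_, ?_, ?_⟩ <;> decide +kernel

/-- Automorphism 4 (translation `(0, 4)`): cover-compatible with `ePermqs[4]`, row-map automorphism of `H^X` and `H^Z`. -/
theorem aut4_ok : A1s_n168_k6_3dfa5349.cov.permCompatOK perm4 (ePermqs.getD 4 []) = true ∧ rowMapOKL hx perm4 rows4 = true ∧ rowMapOKL hz perm4 rows4 = true := by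
  refine ⟨?_, ?_, ?_⟩ <;> decide +kernel

/-- Automorphism 5 (translation `(0, 5)`): cover-compatible with `ePermqs[5]`, row-map automorphism of `H^X` and `H^Z`. -/
theorem aut5_ok : A1s_n168_k6_3dfa5349.cov.permCompatOK perm5 (ePermqs.getD 5 []) = true ∧ rowMapOKL hx perm5 rows5 = true ∧ rowMapOKL hz perm5 rows5 = true := by
  refine ⟨?_, ?_, ?_⟩ <;> decide +kernel

/-- Automorphism 6 (translation `(0, 6)`): cover-compatible with `ePermqs[6]`, row-map automorphism of `H^X` and `H^Z`. -/
theorem aut6_ok : A1s_n168_k6_3dfa5349.cov.permCompatOK perm6 (ePermqs.getD 6 []) = true ∧ rowMapOKL hx perm6 rows6 = true ∧ rowMapOKL hz perm6 rows6 = true := by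
  refine ⟨?_, ?_, ?_⟩ <;> decide +kernel

/-- Automorphism 7 (translation `(0, 7)`): cover-compatible with `ePermqs[7]`, row-map automorphism of `H^X` and `H^Z`. -/
theorem aut7_ok : A1s_n168_k6_3dfa5349.cov.permCompatOK perm7 (ePermqs.getD 7 []) = true ∧ rowMapOKL hx perm7 rows7 = true ∧ rowMapOKL hz perm7 rows7 = true := by
  refine ⟨?_, ?_, ?_⟩ <;> decide +kernel

/-- Automorphism 8 (translation `(0, 8)`): cover-compatible with `ePermqs[8]`, row-map automorphism of `H^X` and `H^Z`. -/
theorem aut8_ok : A1s_n168_k6_3dfa5349.cov.permCompatOK perm8 (ePermqs.getD 8 []) = true ∧ rowMapOKL hx perm8 rows8 = true ∧ rowMapOKL hz perm8 rows8 = true := by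
  refine ⟨?_, ?_, ?_⟩ <;> decide +kernel

/-- Automorphism 9 (translation `(0, 9)`): cover-compatible with `ePermqs[9]`, row-map automorphism of `H^X` and `H^Z`. -/
theorem aut9_ok : A1s_n168_k6_3dfa5349.cov.permCompatOK perm9 (ePermqs.getD 9 []) = true ∧ rowMapOKL hx perm9 rows9 = true ∧ rowMapOKL hz perm9 rows9 = true := by
  refine ⟨?_, ?_, ?_⟩ <;> decide +kernel

/-- Automorphism 10 (translation `(0, 10)`): cover-compatible with `ePermqs[10]`, row-map automorphism of `H^X` and `H^Z`. -/
theorem aut10_ok : A1s_n168_k6_3dfa5349.cov.permCompatOK perm10 (ePermqs.getD 10 []) = true ∧ rowMapOKL hx perm10 rows10 = true ∧ rowMapOKL hz perm10 rows10 = true := by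
  refine ⟨?_, ?_, ?_⟩ <;> decide +kernel

/-- Automorphism 11 (translation `(0, 11)`): cover-compatible with `ePermqs[11]`, row-map automorphism of `H^X` and `H^Z`. -/
theorem aut11_ok : A1s_n168_k6_3dfa5349.cov.permCompatOK perm11 (ePermqs.getD 11 []) = true ∧ rowMapOKL hx perm11 rows11 = true ∧ rowMapOKL hz perm11 rows11 = true := by
  refine ⟨?_, ?_, ?_⟩ <;> decide +kernel

/-- Automorphism 12 (translation `(0, 12)`): cover-compatible with `ePermqs[12]`, row-map automorphism of `H^X` and `H^Z`. -/
theorem aut12_ok : A1s_n168_k6_3dfa5349.cov.permCompatOK perm12 (ePermqs.getD 12 []) = true ∧ rowMapOKL hx perm12 rows12 = true ∧ rowMapOKL hz perm12 rows12 = true := by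
  refine ⟨?_, ?_, ?_⟩ <;> decide +kernel

/-- Automorphism 13 (translation `(0, 13)`): cover-compatible with `ePermqs[13]`, row-map automorphism of `H^X` and `H^Z`. -/
theorem aut13_ok : A1s_n168_k6_3dfa5349.cov.permCompatOK perm13 (ePermqs.getD 13 []) = true ∧ rowMapOKL hx perm13 rows13 = true ∧ rowMapOKL hz perm13 rows13 = true := by
  refine ⟨?_, ?_, ?_⟩ <;> decide +kernel

/-- Automorphism 14 (translation `(0, 14)`): cover-compatible with `ePermqs[14]`, row-map automorphism of `H^X` and `H^Z`. -/
theorem aut14_ok : A1s_n168_k6_3dfa5349.cov.permCompatOK perm14 (ePermqs.getD 14 []) = true ∧ rowMapOKL hx perm14 rows14 = true ∧ rowMapOKL hz perm14 rows14 = true := by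
  refine ⟨?_, ?_, ?_⟩ <;> decide +kernel

/-- Automorphism 15 (translation `(0, 15)`): cover-compatible with `ePermqs[15]`, row-map automorphism of `H^X` and `H^Z`. -/
theorem aut15_ok : A1s_n168_k6_3dfa5349.cov.permCompatOK perm15 (ePermqs.getD 15 []) = true ∧ rowMapOKL hx perm15 rows15 = true ∧ rowMapOKL hz perm15 rows15 = true := by
  refine ⟨?_, ?_, ?_⟩ <;> decide +kernel

/-- Automorphism 16 (translation `(0, 16)`): cover-compatible with `ePermqs[16]`, row-map automorphism of `H^X` and `H^Z`. -/
theorem aut16_ok : A1s_n168_k6_3dfa5349.cov.permCompatOK perm16 (ePermqs.getD 16 []) = true ∧ rowMapOKL hx perm16 rows16 = true ∧ rowMapOKL hz perm16 rows16 = true := by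
  refine ⟨?_, ?_, ?_⟩ <;> decide +kernel

/-- Automorphism 17 (translation `(0, 17)`): cover-compatible with `ePermqs[17]`, row-map automorphism of `H^X` and `H^Z`. -/
theorem aut17_ok : A1s_n168_k6_3dfa5349.cov.permCompatOK perm17 (ePermqs.getD 17 []) = true ∧ rowMapOKL hx perm17 rows17 = true ∧ rowMapOKL hz perm17 rows17 = true := by
  refine ⟨?_, ?_, ?_⟩ <;> decide +kernel

/-- Automorphism 18 (translation `(0, 18)`): cover-compatible with `ePermqs[18]`, row-map automorphism of `H^X` and `H^Z`. -/
theorem aut18_ok : A1s_n168_k6_3dfa5349.cov.permCompatOK perm18 (ePermqs.getD 18 []) = true ∧ rowMapOKL hx perm18 rows18 = true ∧ rowMapOKL hz perm18 rows18 = true := by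
  refine ⟨?_, ?_, ?_⟩ <;> decide +kernel

/-- Automorphism 19 (translation `(0, 19)`): cover-compatible with `ePermqs[19]`, row-map automorphism of `H^X` and `H^Z`. -/
theorem aut19_ok : A1s_n168_k6_3dfa5349.cov.permCompatOK perm19 (ePermqs.getD 19 []) = true ∧ rowMapOKL hx perm19 rows19 = true ∧ rowMapOKL hz perm19 rows19 = true := by
  refine ⟨?_, ?_, ?_⟩ <;> decide +kernel

/-- Automorphism 20 (translation `(0, 20)`): cover-compatible with `ePermqs[20]`, row-map automorphism of `H^X` and `H^Z`. -/
theorem aut20_ok : A1s_n168_k6_3dfa5349.cov.permCompatOK perm20 (ePermqs.getD 20 []) = true ∧ rowMapOKL hx perm20 rows20 = true ∧ rowMapOKL hz perm20 rows20 = true := by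
  refine ⟨?_, ?_, ?_⟩ <;> decide +kernel

/-- Automorphism 21 (translation `(1, 0)`): cover-compatible with `ePermqs[21]`, row-map automorphism of `H^X` and `H^Z`. -/
theorem aut21_ok : A1s_n168_k6_3dfa5349.cov.permCompatOK perm21 (ePermqs.getD 21 []) = true ∧ rowMapOKL hx perm21 rows21 = true ∧ rowMapOKL hz perm21 rows21 = true := by
  refine ⟨?_, ?_, ?_⟩ <;> decide +kernel

/-- Automorphism 22 (translation `(1, 1)`): cover-compatible with `ePermqs[22]`, row-map automorphism of `H^X` and `H^Z`. -/
theorem aut22_ok : A1s_n168_k6_3dfa5349.cov.permCompatOK perm22 (ePermqs.getD 22 []) = true ∧ rowMapOKL hx perm22 rows22 = true ∧ rowMapOKL hz perm22 rows22 = true := by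
  refine ⟨?_, ?_, ?_⟩ <;> decide +kernel

/-- Automorphism 23 (translation `(1, 2)`): cover-compatible with `ePermqs[23]`, row-map automorphism of `H^X` and `H^Z`. -/
theorem aut23_ok : A1s_n168_k6_3dfa5349.cov.permCompatOK perm23 (ePermqs.getD 23 []) = true ∧ rowMapOKL hx perm23 rows23 = true ∧ rowMapOKL hz perm23 rows23 = true := by
  refine ⟨?_, ?_, ?_⟩ <;> decide +kernel

/-- Automorphism 24 (translation `(1, 3)`): cover-compatible with `ePermqs[24]`, row-map automorphism of `H^X` and `H^Z`. -/
theorem aut24_ok : A1s_n168_k6_3dfa5349.cov.permCompatOK perm24 (ePermqs.getD 24 []) = true ∧ rowMapOKL hx perm24 rows24 = true ∧ rowMapOKL hz perm24 rows24 = true := by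
  refine ⟨?_, ?_, ?_⟩ <;> decide +kernel

/-- Automorphism 25 (translation `(1, 4)`): cover-compatible with `ePermqs[25]`, row-map automorphism of `H^X` and `H^Z`. -/
theorem aut25_ok : A1s_n168_k6_3dfa5349.cov.permCompatOK perm25 (ePermqs.getD 25 []) = true ∧ rowMapOKL hx perm25 rows25 = true ∧ rowMapOKL hz perm25 rows25 = true := by
  refine ⟨?_, ?_, ?_⟩ <;> decide +kernel

/-- Automorphism 26 (translation `(1, 5)`): cover-compatible with `ePermqs[26]`, row-map automorphism of `H^X` and `H^Z`. -/
theorem aut26_ok : A1s_n168_k6_3dfa5349.cov.permCompatOK perm26 (ePermqs.getD 26 []) = true ∧ rowMapOKL hx perm26 rows26 = true ∧ rowMapOKL hz perm26 rows26 = true := by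
  refine ⟨?_, ?_, ?_⟩ <;> decide +kernel

/-- Automorphism 27 (translation `(1, 6)`): cover-compatible with `ePermqs[27]`, row-map automorphism of `H^X` and `H^Z`. -/
theorem aut27_ok : A1s_n168_k6_3dfa5349.cov.permCompatOK perm27 (ePermqs.getD 27 []) = true ∧ rowMapOKL hx perm27 rows27 = true ∧ rowMapOKL hz perm27 rows27 = true := by
  refine ⟨?_, ?_, ?_⟩ <;> decide +kernel

/-- Automorphism 28 (translation `(1, 7)`): cover-compatible with `ePermqs[28]`, row-map automorphism of `H^X` and `H^Z`. -/
theorem aut28_ok : A1s_n168_k6_3dfa5349.cov.permCompatOK perm28 (ePermqs.getD 28 []) = true ∧ rowMapOKL hx perm28 rows28 = true ∧ rowMapOKL hz perm28 rows28 = true := by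
  refine ⟨?_, ?_, ?_⟩ <;> decide +kernel

/-- Automorphism 29 (translation `(1, 8)`): cover-compatible with `ePermqs[29]`, row-map automorphism of `H^X` and `H^Z`. -/
theorem aut29_ok : A1s_n168_k6_3dfa5349.cov.permCompatOK perm29 (ePermqs.getD 29 []) = true ∧ rowMapOKL hx perm29 rows29 = true ∧ rowMapOKL hz perm29 rows29 = true := by
  refine ⟨?_, ?_, ?_⟩ <;> decide +kernel

/-- Automorphism 30 (translation `(1, 9)`): cover-compatible with `ePermqs[30]`, row-map automorphism of `H^X` and `H^Z`. -/
theorem aut30_ok : A1s_n168_k6_3dfa5349.cov.permCompatOK perm30 (ePermqs.getD 30 []) = true ∧ rowMapOKL hx perm30 rows30 = true ∧ rowMapOKL hz perm30 rows30 = true := by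
  refine ⟨?_, ?_, ?_⟩ <;> decide +kernel

/-- Automorphism 31 (translation `(1, 10)`): cover-compatible with `ePermqs[31]`, row-map automorphism of `H^X` and `H^Z`. -/
theorem aut31_ok : A1s_n168_k6_3dfa5349.cov.permCompatOK perm31 (ePermqs.getD 31 []) = true ∧ rowMapOKL hx perm31 rows31 = true ∧ rowMapOKL hz perm31 rows31 = true := by
  refine ⟨?_, ?_, ?_⟩ <;> decide +kernel

/-- Automorphism 32 (translation `(1, 11)`): cover-compatible with `ePermqs[32]`, row-map automorphism of `H^X` and `H^Z`. -/
theorem aut32_ok : A1s_n168_k6_3dfa5349.cov.permCompatOK perm32 (ePermqs.getD 32 []) = true ∧ rowMapOKL hx perm32 rows32 = true ∧ rowMapOKL hz perm32 rows32 = true := by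
  refine ⟨?_, ?_, ?_⟩ <;> decide +kernel

/-- Automorphism 33 (translation `(1, 12)`): cover-compatible with `ePermqs[33]`, row-map automorphism of `H^X` and `H^Z`. -/
theorem aut33_ok : A1s_n168_k6_3dfa5349.cov.permCompatOK perm33 (ePermqs.getD 33 []) = true ∧ rowMapOKL hx perm33 rows33 = true ∧ rowMapOKL hz perm33 rows33 = true := by
  refine ⟨?_, ?_, ?_⟩ <;> decide +kernel

/-- Automorphism 34 (translation `(1, 13)`): cover-compatible with `ePermqs[34]`, row-map automorphism of `H^X` and `H^Z`. -/
theorem aut34_ok : A1s_n168_k6_3dfa5349.cov.permCompatOK perm34 (ePermqs.getD 34 []) = true ∧ rowMapOKL hx perm34 rows34 = true ∧ rowMapOKL hz perm34 rows34 = true := by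
  refine ⟨?_, ?_, ?_⟩ <;> decide +kernel

/-- Automorphism 35 (translation `(1, 14)`): cover-compatible with `ePermqs[35]`, row-map automorphism of `H^X` and `H^Z`. -/
theorem aut35_ok : A1s_n168_k6_3dfa5349.cov.permCompatOK perm35 (ePermqs.getD 35 []) = true ∧ rowMapOKL hx perm35 rows35 = true ∧ rowMapOKL hz perm35 rows35 = true := by
  refine ⟨?_, ?_, ?_⟩ <;> decide +kernel

/-- Automorphism 36 (translation `(1, 15)`): cover-compatible with `ePermqs[36]`, row-map automorphism of `H^X` and `H^Z`. -/
theorem aut36_ok : A1s_n168_k6_3dfa5349.cov.permCompatOK perm36 (ePermqs.getD 36 []) = true ∧ rowMapOKL hx perm36 rows36 = true ∧ rowMapOKL hz perm36 rows36 = true := by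
  refine ⟨?_, ?_, ?_⟩ <;> decide +kernel

/-- Automorphism 37 (translation `(1, 16)`): cover-compatible with `ePermqs[37]`, row-map automorphism of `H^X` and `H^Z`. -/
theorem aut37_ok : A1s_n168_k6_3dfa5349.cov.permCompatOK perm37 (ePermqs.getD 37 []) = true ∧ rowMapOKL hx perm37 rows37 = true ∧ rowMapOKL hz perm37 rows37 = true := by
  refine ⟨?_, ?_, ?_⟩ <;> decide +kernel

/-- Automorphism 38 (translation `(1, 17)`): cover-compatible with `ePermqs[38]`, row-map automorphism of `H^X` and `H^Z`. -/
theorem aut38_ok : A1s_n168_k6_3dfa5349.cov.permCompatOK perm38 (ePermqs.getD 38 []) = true ∧ rowMapOKL hx perm38 rows38 = true ∧ rowMapOKL hz perm38 rows38 = true := by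
  refine ⟨?_, ?_, ?_⟩ <;> decide +kernel

/-- Automorphism 39 (translation `(1, 18)`): cover-compatible with `ePermqs[39]`, row-map automorphism of `H^X` and `H^Z`. -/
theorem aut39_ok : A1s_n168_k6_3dfa5349.cov.permCompatOK perm39 (ePermqs.getD 39 []) = true ∧ rowMapOKL hx perm39 rows39 = true ∧ rowMapOKL hz perm39 rows39 = true := by
  refine ⟨?_, ?_, ?_⟩ <;> decide +kernel

/-- Automorphism 40 (translation `(1, 19)`): cover-compatible with `ePermqs[40]`, row-map automorphism of `H^X` and `H^Z`. -/
theorem aut40_ok : A1s_n168_k6_3dfa5349.cov.permCompatOK perm40 (ePermqs.getD 40 []) = true ∧ rowMapOKL hx perm40 rows40 = true ∧ rowMapOKL hz perm40 rows40 = true := by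
  refine ⟨?_, ?_, ?_⟩ <;> decide +kernel

/-- Automorphism 41 (translation `(1, 20)`): cover-compatible with `ePermqs[41]`, row-map automorphism of `H^X` and `H^Z`. -/
theorem aut41_ok : A1s_n168_k6_3dfa5349.cov.permCompatOK perm41 (ePermqs.getD 41 []) = true ∧ rowMapOKL hx perm41 rows41 = true ∧ rowMapOKL hz perm41 rows41 = true := by
  refine ⟨?_, ?_, ?_⟩ <;> decide +kernel

/-- **`hauts`**: the automorphism tables of T1 (42 translations, index `i ↔ (i / 21, i % 21)`). -/
theorem hauts : autsCompatOK A1s_n168_k6_3dfa5349.cov hx hz perms ePermqs rowss rowss = true := by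
  refine autsCompatOK_of_forallL (by decide) fun i hi => ?_
  have hi' : i < 42 := by simpa [perms] using hi
  interval_cases i
  · exact aut0_ok
  · exact aut1_ok
  · exact aut2_ok
  · exact aut3_ok
  · exact aut4_ok
  · exact aut5_ok
  · exact aut6_ok
  · exact aut7_ok
  · exact aut8_ok
  · exact aut9_ok
  · exact aut10_ok
  · exact aut11_ok
  · exact aut12_ok
  · exact aut13_ok
  · exact aut14_ok
  · exact aut15_ok
  · exact aut16_ok
  · exact aut17_ok
  · exact aut18_ok
  · exact aut19_ok
  · exact aut20_ok
  · exact aut21_ok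
  · exact aut22_ok
  · exact aut23_ok
  · exact aut24_ok
  · exact aut25_ok
  · exact aut26_ok
  · exact aut27_ok
  · exact aut28_ok
  · exact aut29_ok
  · exact aut30_ok
  · exact aut31_ok
  · exact aut32_ok
  · exact aut33_ok
  · exact aut34_ok
  · exact aut35_ok
  · exact aut36_ok
  · exact aut37_ok
  · exact aut38_ok
  · exact aut39_ok
  · exact aut40_ok
  · exact aut41_ok

end Summit.Ventures.QEC.Census.A1s_n168_k6_3dfa5349
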